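import Literature.MathematicalPhysics.QuantumFieldTheory.Balaban1983to89.HaarEigenvalueSphereNull
import Literature.MathematicalPhysics.QuantumFieldTheory.Balaban1983to89.PlaquetteVariableHaarLaw
import Literature.MathematicalPhysics.QuantumFieldTheory.Balaban1983to89.B12ContinuousTransportInvarianceOn
import Mathlib.Topology.Algebra.Indicator

/-!
# NODE N09 · (F2) AT NODE 00's OBJECTS — EVERY SHARP PLAQUETTE-THRESHOLD SET `{V : |V(∂p) − 1| < δ ∀p}` (`δ ≠ 0`) OF `SU(N)`-CONFIGURATIONS HAS
# A `dU`-NULL THRESHOLD SET AND A `dU`-NULL FRONTIER, AND ITS INDICATOR IS `dU`-A.E. CONTINUOUS; at the record: the small-field domain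
# `domAltOfRecord ν K k` ([Balaban1987RG1] p. 259, second form), the (1.2)∕(8) regularity classes `bgReg K k ε`, and the β-slot χ `chiFixAltOfRecord = chiFixed7`

Cell `pub-ymgap` (YM-PLAN Track A), DAG node N09 [Balaban1987RG1] (= [I]); seat `pub-ymgap-dag-n09-w1` g4; count-neutral helper keyed to K1⁷
`stmt-QuantumFields-20542` (`--kind proof --supports … --as helper`).  HONEST FRAMING: kernel measure theory at NODE 00's definitions; NOTHING of
Bałaban's analysis asserted; N09 NOT discharged; K0⁷∕K1⁷ NOT closed; counts unmoved; one finite 𝕋⁴ programme at fixed ε — R4 closes the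
conditional rung `BalabanLadder.UV` only; the Yang–Mills mass gap (Clay) is NOT proved by any of this; nothing continuum ∕ ℝ⁴ ∕ OS.

THE LOCATED DEBT.  N09's list of record (`BalabanUVNodesN09AtSmallFieldBookkeeping`, dag-n09-w3 g2 memo §2) item 4 is the analytic binder
`hreg : domAltOfRecord ν K (j+1) ⊆ regSetOfRecord K j ρ_j` = def-T∕K0e's on-domain β-version proviso, whose located standard-analysis debts are
(F1)–(F3) of `pub-ymgap-node00-def-K0e/P7-LOCATOR-AUDIT.md` §4; **(F2) = «LEVEL-SET NULLITY … needed because the SHARP `𝟙_{domAlt_k}` is integrated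
over fibres: … the configurations … whose fibre point has a fine plaquette EXACTLY at threshold ε₀ must be null»**.  This file proves the
FULL-MEASURE (product Haar `dU = fieldMeasure`) form of that sentence at the record's own objects, for EVERY sharp plaquette-threshold class at once
(§2: `{V | PlaqSmall δ V}`, `δ ≠ 0`): the configurations with some plaquette variable EXACTLY at the threshold are `dU`-null (§1), the class is open
with `dU`-null frontier and its closure has the same mass, and its 0∕1 indicator is continuous at `dU`-almost every configuration; §3 reads this at
`domAltOfRecord ν K k` (δ = `ν.ε₀`), at node00-def-B's regularity classes `bgReg K k ε` (δ = `ε·η_k²`, the (8)∕(1.2) species), and at def-χ's β-slot χ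
of record `chiFixAltOfRecord ν K k = chiFixed7 ν K g k` ([I] p. 259 «|∂V − 1| < ε₀ on T₁^{(k)}»): `dU`-a.e. continuous — the dominated-convergence
input that a sharp cut-off costs, in full-measure currency.
Inputs BY NAME: `HaarEigenvalueSphereNull.haar_setOf_dist1_eq_eq_zero_specialUnitaryGroup` (group-level (F2): `Haar{g ∈ SU(N) : |g − 1| = r} = 0`,
`r ≠ 0`, through lit-balaban p28's [BrockerTomDieck1985] IV (2.11) zero-set engine), `PlaquetteVariableHaarLaw.fieldMeasure_setOf_exists_dist1_plaqHol_eq_eq_zero`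
(the law of a plaquette variable under `dU` is Haar), dag-n09-a's `B12ContinuousTransportInvarianceOn.continuous_dist1_SU` ∕ `continuous_plaqHol_SU`
(and, for comparison, `isOpen_domAltOfRecord`, re-derived here from the generic §2), def-χ's `Node00.chiFixAltOfRecord_eq_indicator`, Mathlib
`ContinuousOn.continuousAt_indicator`.

WHAT IS PROVED (theorems only; 0 def; 0 sorry; axioms standard).  `N` with `[NeZero N]`; `P : Params`, `j : ℕ`, `δ : ℝ`; `F : T4Family`, `ν : Stage7Numerics`.
* §1 ★ `fieldMeasure_setOf_exists_dist1_plaqHol_eq_eq_zero_SU` (`δ ≠ 0`: `dU{U : ∃ p, |U(∂p) − 1| = δ} = 0`), `ae_forall_dist1_plaqHol_ne_SU`.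
* §2 (generic sharp class `{V | PlaqSmall δ V}` of `SU(N)`-configurations) `isOpen_setOf_plaqSmall_SU`, `closure_setOf_plaqSmall_subset` (`⊆ {∀ p, ≤ δ}`),
  ★ `frontier_setOf_plaqSmall_subset` (`⊆` the threshold set), ★★ `fieldMeasure_frontier_setOf_plaqSmall_eq_zero`, `fieldMeasure_closure_setOf_plaqSmall_eq`,
  `continuousAt_indicator_setOf_plaqSmall`, ★★ `ae_continuousAt_indicator_setOf_plaqSmall` (every `c : ℝ`-valued constant indicator `𝟙·c`),
  `ae_continuousAt_chiSmall_univ` (`Setup.chiSmall univ δ`).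
* §3 AT THE RECORD: ★★ `fieldMeasure_thresholdSet_domAltOfRecord_eq_zero`, `frontier_domAltOfRecord_subset`, ★★ `fieldMeasure_frontier_domAltOfRecord_eq_zero`,
  `fieldMeasure_closure_domAltOfRecord_eq`, `continuousAt_chiFixAltOfRecord_of_forall_ne`, ★★★ `ae_continuousAt_chiFixAltOfRecord`, `ae_continuousAt_chiFixed7`;
  `fieldMeasure_frontier_bgReg_eq_zero` ∕ `ae_continuousAt_indicator_bgReg` (node00-def-B's `bgReg K k ε`, `ε ≠ 0`, every level `k`).

HONEST SCOPE.  (i) FULL product-Haar currency only: the FIBRE reading of (F2) (nullity for the conditional law of the fine field given its block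
average `V̄`, which is what the transform `T_k` integrates) is NOT proved — it needs (F1), the Jacobian face of (0.4) (K0e `F1-PROGRAMME-DESIGN.md`),
untouched; (F3) untouched; hence `hreg`∕`contTOn` stay DISPLAYED on every N09 door.  (ii) `δ ≠ 0` (`ν.ε₀ ≠ 0`, `ε ≠ 0`) is a hypothesis (the numerics
of record have `0 < ε₀`; at threshold `0` the class is empty and the threshold set `{∃ p, V(∂p) = 1}` is not null in general).  (iii) Nothing of
dag-n09-a ∕ def-χ ∕ def-B ∕ lit-balaban is re-proved or re-pointed.
-/

noncomputable section

open MeasureTheory Set Filter Topology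
open Literature.MathematicalPhysics.QuantumFieldTheory
open Literature.MathematicalPhysics.QuantumFieldTheory.Balaban1983to89
open Literature.MathematicalPhysics.QuantumFieldTheory.Balaban1983to89.Node00
open Literature.MathematicalPhysics.QuantumFieldTheory.Balaban1983to89.T4Continuum (T4Family)
open Literature.MathematicalPhysics.QuantumFieldTheory.Balaban1983to89.B12ContinuousTransportInvarianceOn
  (continuous_dist1_SU continuous_plaqHol_SU)
open Literature.MathematicalPhysics.QuantumFieldTheory.Balaban1983to89.HaarEigenvalueSphereNull
  (haar_setOf_dist1_eq_eq_zero_specialUnitaryGroup)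
open Literature.MathematicalPhysics.QuantumFieldTheory.Balaban1983to89.PlaquetteVariableHaarLaw
  (fieldMeasure_setOf_exists_dist1_plaqHol_eq_eq_zero)

namespace Summit.QuantumFields.YangMills.BalabanUVNodes.N09DomAltThresholdNull

variable (N : ℕ) [NeZero N]

/-! ## §1 Plaquette-threshold sets of `SU(N)`-configurations are `dU`-null -/

section Threshold

/-- **`dU{U : ∃ p, |U(∂p) − 1| = δ} = 0` on `SU(N)`-valued configurations** of every torus `P`, every level `j`, every `δ ≠ 0` (group-level (F2)
`HaarEigenvalueSphereNull.haar_setOf_dist1_eq_eq_zero_specialUnitaryGroup` + the plaquette law `PlaquetteVariableHaarLaw`). [cite: Balaban1987RG1, p.259] -/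
theorem fieldMeasure_setOf_exists_dist1_plaqHol_eq_eq_zero_SU (P : Params) (j : ℕ) {δ : ℝ} (hδ : δ ≠ 0) :
    fieldMeasure P j (SU N) {U | ∃ p : Plaq P j, dist1 (GaugeField.plaqHol U p) = δ} = 0 :=
  fieldMeasure_setOf_exists_dist1_plaqHol_eq_eq_zero (haar_setOf_dist1_eq_eq_zero_specialUnitaryGroup (n := Fin N) hδ)

/-- Almost-everywhere form: `dU`-a.e. `SU(N)`-configuration has `|U(∂p) − 1| ≠ δ` for EVERY plaquette `p` (`δ ≠ 0`). [cite: Balaban1987RG1, p.259] -/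
theorem ae_forall_dist1_plaqHol_ne_SU (P : Params) (j : ℕ) {δ : ℝ} (hδ : δ ≠ 0) :
    ∀ᵐ U ∂fieldMeasure P j (SU N), ∀ p : Plaq P j, dist1 (GaugeField.plaqHol U p) ≠ δ := by
  rw [ae_iff]
  simpa only [not_forall, not_not] using fieldMeasure_setOf_exists_dist1_plaqHol_eq_eq_zero_SU N P j hδ

end Threshold

/-! ## §2 The generic sharp class `{V | PlaqSmall δ V}`: open, `dU`-null frontier, a.e.-continuous indicator -/

section PlaqSmallClass

variable (P : Params) (j : ℕ) (δ : ℝ)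

/-- The sharp class `{V : |V(∂p) − 1| < δ ∀p}` is OPEN (finitely many strict inequalities of continuous functions; dag-n09-a's `isOpen_domAltOfRecord` is the
case `δ = ν.ε₀`). [cite: Balaban1987RG1, p.259 and (1.2) p.260] -/
theorem isOpen_setOf_plaqSmall_SU : IsOpen {V : GaugeField P j (SU N) | PlaqSmall δ V} := by
  have h : {V : GaugeField P j (SU N) | PlaqSmall δ V} = ⋂ p : Plaq P j, {V | dist1 (GaugeField.plaqHol V p) < δ} := by
    ext V; simp only [PlaqSmall, Set.mem_setOf_eq, Set.mem_iInter]
  rw [h]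
  exact isOpen_iInter_of_finite fun p => isOpen_lt (continuous_dist1_SU.comp (continuous_plaqHol_SU p)) continuous_const

/-- Its closure lies in the closed set `{V : |V(∂p) − 1| ≤ δ ∀p}`. [cite: Balaban1987RG1, p.259] -/
theorem closure_setOf_plaqSmall_subset :
    closure {V : GaugeField P j (SU N) | PlaqSmall δ V} ⊆ {V | ∀ p : Plaq P j, dist1 (GaugeField.plaqHol V p) ≤ δ} := by
  have hclosed : IsClosed {V : GaugeField P j (SU N) | ∀ p : Plaq P j, dist1 (GaugeField.plaqHol V p) ≤ δ} := by
    have h : {V : GaugeField P j (SU N) | ∀ p : Plaq P j, dist1 (GaugeField.plaqHol V p) ≤ δ} =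
        ⋂ p : Plaq P j, {V | dist1 (GaugeField.plaqHol V p) ≤ δ} := by
      ext V; simp only [Set.mem_setOf_eq, Set.mem_iInter]
    rw [h]
    exact isClosed_iInter fun p => isClosed_le (continuous_dist1_SU.comp (continuous_plaqHol_SU p)) continuous_const
  exact closure_minimal (fun V hV p => le_of_lt (hV p)) hclosed

/-- **THE FRONTIER OF THE SHARP CLASS LIES IN ITS THRESHOLD SET** `{V : ∃ p, |V(∂p) − 1| = δ}` (open class: a frontier point is a closure point outside it).
[cite: Balaban1987RG1, p.259] -/
theorem frontier_setOf_plaqSmall_subset :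
    frontier {V : GaugeField P j (SU N) | PlaqSmall δ V} ⊆ {V | ∃ p : Plaq P j, dist1 (GaugeField.plaqHol V p) = δ} := by
  intro V hV
  rw [frontier, (isOpen_setOf_plaqSmall_SU N P j δ).interior_eq] at hV
  obtain ⟨hcl, hnot⟩ := hV
  have hle := closure_setOf_plaqSmall_subset N P j δ hcl
  simp only [Set.mem_setOf_eq, PlaqSmall, not_forall, not_lt] at hnot
  obtain ⟨p, hp⟩ := hnot
  exact ⟨p, le_antisymm (hle p) hp⟩

/-- **THE FRONTIER OF THE SHARP CLASS IS `dU`-NULL** (`δ ≠ 0`). [cite: Balaban1987RG1, p.259] -/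
theorem fieldMeasure_frontier_setOf_plaqSmall_eq_zero {δ : ℝ} (hδ : δ ≠ 0) :
    fieldMeasure P j (SU N) (frontier {V : GaugeField P j (SU N) | PlaqSmall δ V}) = 0 :=
  measure_mono_null (frontier_setOf_plaqSmall_subset N P j δ) (fieldMeasure_setOf_exists_dist1_plaqHol_eq_eq_zero_SU N P j hδ)

/-- The closure of the sharp class has the same `dU`-mass as the class (`δ ≠ 0`). [cite: Balaban1987RG1, p.259] -/
theorem fieldMeasure_closure_setOf_plaqSmall_eq {δ : ℝ} (hδ : δ ≠ 0) :
    fieldMeasure P j (SU N) (closure {V : GaugeField P j (SU N) | PlaqSmall δ V}) = fieldMeasure P j (SU N) {V | PlaqSmall δ V} := by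
  refine le_antisymm ?_ (measure_mono subset_closure)
  rw [closure_eq_self_union_frontier]
  calc fieldMeasure P j (SU N) ({V : GaugeField P j (SU N) | PlaqSmall δ V} ∪ frontier {V | PlaqSmall δ V})
      ≤ fieldMeasure P j (SU N) {V | PlaqSmall δ V} + fieldMeasure P j (SU N) (frontier {V : GaugeField P j (SU N) | PlaqSmall δ V}) :=
        measure_union_le _ _
    _ = fieldMeasure P j (SU N) {V | PlaqSmall δ V} := by rw [fieldMeasure_frontier_setOf_plaqSmall_eq_zero N P j hδ, add_zero]

/-- The indicator `𝟙_{PlaqSmall δ}·c` is continuous at every configuration off the frontier (Mathlib `ContinuousOn.continuousAt_indicator`).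
[cite: Balaban1987RG1, p.259] -/
theorem continuousAt_indicator_setOf_plaqSmall (c : ℝ) {V : GaugeField P j (SU N)}
    (hV : V ∉ frontier {V : GaugeField P j (SU N) | PlaqSmall δ V}) :
    ContinuousAt ({V : GaugeField P j (SU N) | PlaqSmall δ V}.indicator fun _ => c) V :=
  continuousOn_const.continuousAt_indicator hV

/-- **THE SHARP INDICATOR `𝟙_{PlaqSmall δ}·c` IS `dU`-A.E. CONTINUOUS** (`δ ≠ 0`). [cite: Balaban1987RG1, p.259] -/
theorem ae_continuousAt_indicator_setOf_plaqSmall {δ : ℝ} (hδ : δ ≠ 0) (c : ℝ) :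
    ∀ᵐ V ∂fieldMeasure P j (SU N), ContinuousAt ({V : GaugeField P j (SU N) | PlaqSmall δ V}.indicator fun _ => c) V := by
  filter_upwards [ae_forall_dist1_plaqHol_ne_SU N P j hδ] with V hV
  refine continuousAt_indicator_setOf_plaqSmall N P j δ c fun h => ?_
  obtain ⟨p, hp⟩ := frontier_setOf_plaqSmall_subset N P j δ h
  exact hV p hp

/-- `Setup`'s characteristic function `chiSmall univ δ` (the density factor `χ({|U(∂p) − 1| < δ, all p})`) is the indicator of the sharp class.
[cite: Balaban1988Convergent, (1.4) p.247] -/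
theorem chiSmall_univ_eq_indicator :
    (chiSmall (Set.univ : Set (Plaq P j)) δ : GaugeField P j (SU N) → ℝ) = {V : GaugeField P j (SU N) | PlaqSmall δ V}.indicator fun _ => 1 := by
  funext V
  by_cases hV : PlaqSmall δ V
  · have hV' : PlaqSmallOn Set.univ δ V := fun p _ => hV p
    rw [Set.indicator_of_mem (show V ∈ {V : GaugeField P j (SU N) | PlaqSmall δ V} from hV), chiSmall, if_pos hV']
  · have hV' : ¬ PlaqSmallOn Set.univ δ V := fun h => hV fun p => h p (Set.mem_univ p)
    rw [Set.indicator_of_notMem (show V ∉ {V : GaugeField P j (SU N) | PlaqSmall δ V} from hV), chiSmall, if_neg hV']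

/-- **`chiSmall univ δ` IS `dU`-A.E. CONTINUOUS** on `SU(N)`-configurations (`δ ≠ 0`). [cite: Balaban1988Convergent, (1.4) p.247] -/
theorem ae_continuousAt_chiSmall_univ {δ : ℝ} (hδ : δ ≠ 0) :
    ∀ᵐ V ∂fieldMeasure P j (SU N), ContinuousAt (chiSmall (Set.univ : Set (Plaq P j)) δ : GaugeField P j (SU N) → ℝ) V := by
  rw [chiSmall_univ_eq_indicator]
  exact ae_continuousAt_indicator_setOf_plaqSmall N P j hδ 1

end PlaqSmallClass

/-! ## §3 At the record: `domAltOfRecord`, `chiFixAltOfRecord = chiFixed7`, and node00-def-B's `bgReg` -/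

section Record

variable (F : T4Family)

/-- **THE THRESHOLD SET OF `domAltOfRecord ν K k` IS `dU`-NULL**: `dU{V : ∃ p, |V(∂p) − 1| = ν.ε₀} = 0` whenever `ν.ε₀ ≠ 0` — the configurations of
`T^{(k)}` with some plaquette variable exactly at the small-field threshold of [I] p. 259 (second form). [cite: Balaban1987RG1, p.259] -/
theorem fieldMeasure_thresholdSet_domAltOfRecord_eq_zero (ν : Stage7Numerics) (hε : ν.ε₀ ≠ 0) (K k : ℕ) :
    fieldMeasure (F.P K) k (SU N) {V | ∃ p : Plaq (F.P K) k, dist1 (GaugeField.plaqHol V p) = ν.ε₀} = 0 :=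
  fieldMeasure_setOf_exists_dist1_plaqHol_eq_eq_zero_SU N (F.P K) k hε

/-- `domAltOfRecord ν K k` IS the sharp class `{V | PlaqSmall ν.ε₀ V}` (definitional). [cite: Balaban1987RG1, p.259] -/
theorem domAltOfRecord_eq_setOf_plaqSmall (ν : Stage7Numerics) (K k : ℕ) :
    domAltOfRecord F N ν K k = {V : GaugeField (F.P K) k (SU N) | PlaqSmall ν.ε₀ V} := rfl

/-- **THE FRONTIER OF THE DOMAIN OF RECORD LIES IN ITS THRESHOLD SET.** [cite: Balaban1987RG1, p.259] -/
theorem frontier_domAltOfRecord_subset (ν : Stage7Numerics) (K k : ℕ) :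
    frontier (domAltOfRecord F N ν K k) ⊆ {V | ∃ p : Plaq (F.P K) k, dist1 (GaugeField.plaqHol V p) = ν.ε₀} :=
  frontier_setOf_plaqSmall_subset N (F.P K) k ν.ε₀

/-- **THE FRONTIER OF THE DOMAIN OF RECORD IS `dU`-NULL** (`ν.ε₀ ≠ 0`). [cite: Balaban1987RG1, p.259] -/
theorem fieldMeasure_frontier_domAltOfRecord_eq_zero (ν : Stage7Numerics) (hε : ν.ε₀ ≠ 0) (K k : ℕ) :
    fieldMeasure (F.P K) k (SU N) (frontier (domAltOfRecord F N ν K k)) = 0 :=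
  fieldMeasure_frontier_setOf_plaqSmall_eq_zero N (F.P K) k hε

/-- The closure of the domain of record has the same `dU`-mass as the domain (`ν.ε₀ ≠ 0`). [cite: Balaban1987RG1, p.259] -/
theorem fieldMeasure_closure_domAltOfRecord_eq (ν : Stage7Numerics) (hε : ν.ε₀ ≠ 0) (K k : ℕ) :
    fieldMeasure (F.P K) k (SU N) (closure (domAltOfRecord F N ν K k)) = fieldMeasure (F.P K) k (SU N) (domAltOfRecord F N ν K k) :=
  fieldMeasure_closure_setOf_plaqSmall_eq N (F.P K) k hε

/-- Off the threshold set the β-slot indicator is continuous: `(∀ p, |V(∂p) − 1| ≠ ε₀) ⇒ ContinuousAt (chiFixAltOfRecord ν K k) V`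
(def-χ's `chiFixAltOfRecord_eq_indicator`). [cite: Balaban1987RG1, p.259] -/
theorem continuousAt_chiFixAltOfRecord_of_forall_ne (ν : Stage7Numerics) (K k : ℕ) {V : GaugeField (F.P K) k (SU N)}
    (hV : ∀ p : Plaq (F.P K) k, dist1 (GaugeField.plaqHol V p) ≠ ν.ε₀) : ContinuousAt (chiFixAltOfRecord F N ν K k) V := by
  rw [chiFixAltOfRecord_eq_indicator]
  refine continuousOn_const.continuousAt_indicator fun h => ?_
  obtain ⟨p, hp⟩ := frontier_domAltOfRecord_subset N F ν K k h
  exact hV p hp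

/-- **THE SHARP SMALL-FIELD INDICATOR OF RECORD IS `dU`-A.E. CONTINUOUS**: for `ν.ε₀ ≠ 0`, at every torus `F.P K` and every level `k`,
`∀ᵐ V ∂dU, ContinuousAt (chiFixAltOfRecord ν K k) V` — the (F2) input of the P7 locator audit in FULL product-Haar currency (the fibre∕conditional-law
reading needs (F1) and is NOT claimed). [cite: Balaban1987RG1, p.259] -/
theorem ae_continuousAt_chiFixAltOfRecord (ν : Stage7Numerics) (hε : ν.ε₀ ≠ 0) (K k : ℕ) :
    ∀ᵐ V ∂fieldMeasure (F.P K) k (SU N), ContinuousAt (chiFixAltOfRecord F N ν K k) V := by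
  filter_upwards [ae_forall_dist1_plaqHol_ne_SU N (F.P K) k hε] with V hV
  exact continuousAt_chiFixAltOfRecord_of_forall_ne N F ν K k hV

/-- The same for the β-slot token of record `chiFixed7 ν K g k` (= `chiFixAltOfRecord ν K k`, coupling-blind by typing): `dU`-a.e. continuous for every
coupling sequence `g`. [cite: Balaban1987RG1, p.259] -/
theorem ae_continuousAt_chiFixed7 (ν : Stage7Numerics) (hε : ν.ε₀ ≠ 0) (K : ℕ) (g : ℕ → ℝ) (k : ℕ) :
    ∀ᵐ V ∂fieldMeasure (F.P K) k (SU N), ContinuousAt (chiFixed7 F N ν K g k) V :=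
  ae_continuousAt_chiFixAltOfRecord N F ν hε K k

/-- `η_k = L^{−k} > 0`, so the (8)∕(1.2) threshold `ε·η_k²` is non-zero iff `ε` is. [cite: Balaban1987RG1, (1.2) p.260] -/
theorem mul_eta_sq_ne_zero (K k : ℕ) {ε : ℝ} (hε : ε ≠ 0) : ε * (F.P K).eta k ^ 2 ≠ 0 := by
  have hL : (0 : ℝ) < (F.P K).L := Nat.cast_pos.2 (F.P K).L_pos
  have hη : 0 < (F.P K).eta k := by unfold Params.eta; exact pow_pos (inv_pos.2 hL) k
  exact mul_ne_zero hε (pow_ne_zero 2 hη.ne')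

/-- **node00-def-B's REGULARITY CLASSES `bgReg K k ε = {U : |U(∂p) − 1| < ε·η_k² ∀p}` (the (8)∕(1.2) species on the fine lattice) HAVE `dU`-NULL FRONTIER**
for every `ε ≠ 0` and every level `k`. [cite: Balaban1987RG1, (1.2) p.260] -/
theorem fieldMeasure_frontier_bgReg_eq_zero (K k : ℕ) {ε : ℝ} (hε : ε ≠ 0) :
    fieldMeasure (F.P K) 0 (SU N) (frontier (bgReg F N K k ε)) = 0 :=
  fieldMeasure_frontier_setOf_plaqSmall_eq_zero N (F.P K) 0 (mul_eta_sq_ne_zero F K k hε)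

/-- The threshold set of `bgReg K k ε` is `dU`-null (`ε ≠ 0`). [cite: Balaban1987RG1, (1.2) p.260] -/
theorem fieldMeasure_thresholdSet_bgReg_eq_zero (K k : ℕ) {ε : ℝ} (hε : ε ≠ 0) :
    fieldMeasure (F.P K) 0 (SU N) {U | ∃ p : Plaq (F.P K) 0, dist1 (GaugeField.plaqHol U p) = ε * (F.P K).eta k ^ 2} = 0 :=
  fieldMeasure_setOf_exists_dist1_plaqHol_eq_eq_zero_SU N (F.P K) 0 (mul_eta_sq_ne_zero F K k hε)

/-- The indicator of `bgReg K k ε` is `dU`-a.e. continuous (`ε ≠ 0`). [cite: Balaban1987RG1, (1.2) p.260] -/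
theorem ae_continuousAt_indicator_bgReg (K k : ℕ) {ε : ℝ} (hε : ε ≠ 0) (c : ℝ) :
    ∀ᵐ U ∂fieldMeasure (F.P K) 0 (SU N), ContinuousAt ((bgReg F N K k ε).indicator fun _ => c) U :=
  ae_continuousAt_indicator_setOf_plaqSmall N (F.P K) 0 (mul_eta_sq_ne_zero F K k hε) c

end Record

end Summit.QuantumFields.YangMills.BalabanUVNodes.N09DomAltThresholdNull

end
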